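import Mathlib.LinearAlgebra.Matrix.NonsingularInverse
import Mathlib.LinearAlgebra.Matrix.Rank
import Mathlib.LinearAlgebra.Matrix.Bilinear
import Mathlib.LinearAlgebra.FiniteDimensional.Lemmas
import Literature.Barriers.Schanuel.AlgebraicIndependenceOfLogarithms
import Literature.Barriers.Schanuel.LinearSubgroupMethodLimit
import HarnessLib

/-!
# Barrier (Schanuel): `s ≤ 2r` — Roy's Corollary 1.3 from the linear subgroup theorem (proved)

Companion to `Literature.Barriers.Schanuel.AlgebraicIndependenceOfLogarithms`, whose named fact
`Literature.Barriers.Schanuel.roy1995_structuralRank_le_two_mul_rank` renders the non-trivial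
half of "Define the structural rank of a matrix `M ∈ M_{d,l}(𝓛)` as the smallest integer `s` for
which `M_{d,l}(s)` contains a subspace of `M_{d,l}` defined over `ℚ` containing `M`. Then,
Corollary 1.3 shows that the rank `r` of `M` satisfies `r ≤ s ≤ 2r`" [Roy1995, §1 Remark (i)
p. 54], i.e. the `T`-part of

> **Corollary 1.3.** Let `d, l, r` be positive integers. For each `M ∈ M_{d,l}(r)(𝓛)` there exist
> subspaces `S` and `T` of `M_{d,l}` defined over `ℚ` with `M ∈ T ⊆ M_{d,l}(2r)`,
> `S ⊆ T ∩ M_{d,l}(r)` and `dim(S) ≥ dim(T) − 2r²` [Roy1995, §1 p. 52].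

## Status of the fact

Roy deduces Corollary 1.3 from **Theorem 1.2** (M. Waldschmidt's linear subgroup theorem for
matrices of logarithms [Waldschmidt, Invent. Math. 63 (1981), Thm 2.1], quoted as
[Roy1995, §1 Theorem 1.2]) — a transcendence theorem proved by Schneider's method in several
variables with zero estimates on algebraic groups; it is the tree's named fact
`Literature.Barriers.Schanuel.waldschmidt1981_linearSubgroup_matrix`
(`Literature/Barriers/Schanuel/LinearSubgroupMethodLimit.lean`). What this file PROVES is the
complete printed deduction: **Theorem 1.2 ⟹ `s ≤ 2r`**
(`roy1995_structuralRank_le_two_mul_rank_of_linearSubgroup`), so that the fact is reduced exactly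
to its transcendence input. Together with the companion's trivial half `rank_le_structuralRank`
this is Roy's `r ≤ s ≤ 2r` (`rank_le_structuralRank_and_le_two_mul_rank_of_linearSubgroup`).
This file deliberately imports nothing transcendental. The input has since been PROVED in the
tree (`Literature.NumberTheory.Transcendental.Waldschmidt1981.thm_2_1_holds`,
`Literature/NumberTheory/Transcendental/SixExponentialsSeveralVariablesDischargeProofs.lean`;
Roy's quotation follows by `waldschmidt1981_linearSubgroup_matrix_of_thm_2_1`,
`LinearSubgroupMethodLimitWaldschmidtProofs.lean`, discharged as
`waldschmidt1981_linearSubgroup_matrix_holds`, `LinearSubgroupMethodLimitHolds.lean`), and the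
unconditional discharge `roy1995_structuralRank_le_two_mul_rank_holds` composing it with the
present deduction lives in the sibling
`Literature/Barriers/Schanuel/AlgebraicIndependenceOfLogarithmsStructuralRankDischargeProofs.lean`.

## The printed proof and its rendering (only `T` is needed for the structural rank)

"Proof. Let `M ∈ M_{d,l}(r)(𝓛)`. Without loss of generality we may assume that the rows of `M`
are `ℚ`-linearly independent and that its columns are `ℚ`-linearly independent. … If `l ≤ r`, the
corollary is verified with `S = T = M_{d,l}` … Otherwise, if `dl > r(d+l)` … the hypotheses of
Theorem 1.2 are satisfied. We may thus assume that `M` is of the form (1.1) where `M₁` is a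
`d₁ × l₁` matrix of rank `r₁ > 0` with `d₁, l₁` and `r₁` satisfying (1.2). Since `d > 2r`, the
inequalities (1.2) imply `d₁ > 2r₁` and `l₁ < 2r₁`. Moreover, `M₂` is a `d₂ × l₂` matrix with
coefficients in `𝓛` and rank `r₂ > 0` where `d₂ = d − d₁`, `l₂ = l − l₁` and `r₂ ≤ r − r₁`. By
induction on `d + l`, we may assume that the corollary is verified for `M₂` … `M₂ ∈ T₂ ⊆
M_{d₂,l₂}(2r₂)` … We then take for `T` the set of `d × l` block matrices of the form
`(N₁ 0; N₃ N₂)` with `N₁` of size `d₁ × l₁` and `N₂ ∈ T₂` … We have `M ∈ T` as required and,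
since `r₁ + r₂ ≤ r` and `l₁ < 2r₁`, we also have `T ⊆ M_{d,l}(2r)`" [Roy1995, §1 pp. 53].

Rendering (strong induction on `d + l`, `exists_isDefinedOverRat_two_mul_rank_of_linearSubgroup`):
* a *rational envelope of rank `≤ k`* of `M` is a subspace `T` defined over `ℚ` with
  `M ∈ T ⊆ M_{d,l}(k)` ("`M_{d,l}(k)` contains a subspace defined over `ℚ` containing `M`", the
  set whose infimum is `structuralRank M`); it is transported along `ℂ`-linear maps sending
  rational matrices to rational matrices and not increasing the rank
  (`exists_isDefinedOverRat_map`), in particular along `N ↦ X N Y` for rational `X, Y`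
  (`exists_isDefinedOverRat_map_mul_mul_map`) and along transposition.
* trivial cases `2r ≥ d` or `2r ≥ l`: `T = M_{d,l}` (`exists_isDefinedOverRat_of_height_le`,
  `exists_isDefinedOverRat_of_width_le`);
* "without loss of generality … rows `ℚ`-linearly independent": if not, `M = E · M'` with `E`
  rational and `M'` the matrix `M` deprived of one row (`exists_eq_map_mul_submatrix_succAbove`),
  and the induction hypothesis for `M'` is transported along `N ↦ E N`; columns: transpose;
* main case: `d, l > 2r` gives `r(d+l) < dl` (`LSTHypothesis`), Theorem 1.2 gives
  `A = PMQ = (M₁ 0; M₃ M₂)`; `d > 2r` and `d r₁ ≤ d₁ r` give `d₁ > 2r₁`, then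
  `d₁l₁ ≤ r₁(d₁+l₁)` gives `l₁ < 2r₁`; the block bound `r₁ + rank M₂ ≤ rank A ≤ r`
  (`rank_submatrix_add_rank_submatrix_le`, the printed "`r₂ ≤ r − r₁`"); the induction hypothesis
  for `M₂`; `T̃ = {N : columns ≥ l₁ of N vanish… arbitrary first l₁ columns} + pad(T₂)` has
  members of rank `≤ l₁ + 2 rank M₂ ≤ 2r − 1`; and `T = P⁻¹ T̃ Q⁻¹`.

## References

* [Roy1995] D. Roy, *Points whose coordinates are logarithms of algebraic numbers on algebraic
  varieties*, Acta Math. 175 (1995) 49–73: §1 Theorem 1.2, Corollary 1.3 and its proof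
  (pp. 52–53), Remark (i) (p. 54).
* [Waldschmidt1981] M. Waldschmidt, *Transcendance et exponentielles en plusieurs variables*,
  Invent. Math. 63 (1981) 97–127, Thm 2.1 (quoted from [Roy1995, Thm 1.2]).
-/

noncomputable section

open Complex

namespace Literature.Barriers.Schanuel

/-! ### Linear algebra over a field -/

section LinearAlgebra

variable {K : Type*} [Field K]

/-- Subadditivity of the rank of matrices over a field: `rank (A + B) ≤ rank A + rank B`
(the range of `A + B` lies in the sum of the ranges). [folklore] -/
theorem rank_add_le_rank_add_rank {m n : Type*} [Fintype m] [Fintype n] (A B : Matrix m n K) :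
    (A + B).rank ≤ A.rank + B.rank := by
  unfold Matrix.rank
  rw [Matrix.mulVecLin_add]
  calc Module.finrank K (LinearMap.range (A.mulVecLin + B.mulVecLin))
      ≤ Module.finrank K ↥(LinearMap.range A.mulVecLin ⊔ LinearMap.range B.mulVecLin) := by
        apply Submodule.finrank_mono
        rintro _ ⟨v, rfl⟩
        exact Submodule.add_mem_sup ⟨v, rfl⟩ ⟨v, rfl⟩
    _ ≤ _ := Submodule.finrank_add_le_finrank_add_finrank _ _

/-- **Rank of a block-triangular matrix** (the printed "`r₂ ≤ r − r₁`" for `PMQ = (M₁ 0; M₃ M₂)`),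
in index-free form: if the entries of `A` on the rows `f₁` and the columns `g₂` vanish, then
`rank A[f₁, g₁] + rank A[f₂, g₂] ≤ rank A`. Proof: in the column space `C` of `A`, the span `Y`
of the columns `g₂` is killed by the restriction `π₁` to the rows `f₁`, while `π₁` maps the span
`X` of the columns `g₁` onto the column space of `A[f₁, g₁]`; rank–nullity for `π₁` on `X + Y`
and `dim Y ≥ rank A[f₂, g₂]`. [cite: Roy1995, §1 proof of Corollary 1.3 (p. 53)] -/
theorem rank_submatrix_add_rank_submatrix_le {m n m₁ n₁ m₂ n₂ : Type*} [Fintype m] [Fintype n]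
    [Fintype m₁] [Fintype n₁] [Fintype m₂] [Fintype n₂] (A : Matrix m n K) (f₁ : m₁ → m)
    (g₁ : n₁ → n) (f₂ : m₂ → m) (g₂ : n₂ → n) (h : ∀ i j, A (f₁ i) (g₂ j) = 0) :
    (A.submatrix f₁ g₁).rank + (A.submatrix f₂ g₂).rank ≤ A.rank := by
  classical
  set C : Submodule K (m → K) := Submodule.span K (Set.range A.col) with hC
  set X : Submodule K (m → K) := Submodule.span K (Set.range (A.col ∘ g₁)) with hX
  set Y : Submodule K (m → K) := Submodule.span K (Set.range (A.col ∘ g₂)) with hY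
  let π₁ : (m → K) →ₗ[K] (m₁ → K) := LinearMap.funLeft K K f₁
  let π₂ : (m → K) →ₗ[K] (m₂ → K) := LinearMap.funLeft K K f₂
  have hXC : X ≤ C := Submodule.span_mono (Set.range_comp_subset_range _ _)
  have hYC : Y ≤ C := Submodule.span_mono (Set.range_comp_subset_range _ _)
  have hYker : Y ≤ LinearMap.ker π₁ := by
    rw [hY, Submodule.span_le]
    rintro _ ⟨j, rfl⟩
    rw [SetLike.mem_coe, LinearMap.mem_ker]
    ext i
    exact h i j
  have hX₁ : X.map π₁ = Submodule.span K (Set.range (A.submatrix f₁ g₁).col) := by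
    rw [hX, Submodule.map_span, ← Set.range_comp]
    rfl
  have hY₂ : Y.map π₂ = Submodule.span K (Set.range (A.submatrix f₂ g₂).col) := by
    rw [hY, Submodule.map_span, ← Set.range_comp]
    rfl
  have h1 : (A.submatrix f₁ g₁).rank ≤ Module.finrank K ↥((X ⊔ Y).map π₁) := by
    rw [Matrix.rank_eq_finrank_span_cols, ← hX₁]
    exact Submodule.finrank_mono (Submodule.map_mono le_sup_left)
  have h2 : (A.submatrix f₂ g₂).rank ≤
      Module.finrank K ↥((LinearMap.ker π₁).comap (X ⊔ Y).subtype) := by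
    rw [Matrix.rank_eq_finrank_span_cols, ← hY₂]
    calc Module.finrank K ↥(Y.map π₂) ≤ Module.finrank K ↥Y := Submodule.finrank_map_le _ _
      _ = Module.finrank K ↥(Y.comap (X ⊔ Y).subtype) :=
          (Submodule.comapSubtypeEquivOfLe (le_sup_right : Y ≤ X ⊔ Y)).finrank_eq.symm
      _ ≤ _ := Submodule.finrank_mono (Submodule.comap_mono hYker)
  have h3 : Module.finrank K ↥((X ⊔ Y).map π₁) +
      Module.finrank K ↥((LinearMap.ker π₁).comap (X ⊔ Y).subtype) =
        Module.finrank K ↥(X ⊔ Y) := by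
    rw [← LinearMap.range_domRestrict, ← LinearMap.ker_domRestrict]
    exact LinearMap.finrank_range_add_finrank_ker _
  have h4 : Module.finrank K ↥(X ⊔ Y) ≤ A.rank := by
    rw [Matrix.rank_eq_finrank_span_cols]
    exact Submodule.finrank_mono (sup_le hXC hYC)
  omega

variable {m n m₂ n₂ : Type*}

/-- Entries of `E_f · N` on the image rows (`E_f = 1[·, f]`, `f` injective): row `f k` of
`E_f N` is row `k` of `N`. [folklore] -/
theorem one_submatrix_mul_apply_self [Fintype m₂] [DecidableEq m] (f : m₂ → m)
    (hf : Function.Injective f) (N : Matrix m₂ n₂ K) (k : m₂) (j : n₂) :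
    ((1 : Matrix m m K).submatrix id f * N) (f k) j = N k j := by
  rw [Matrix.mul_apply, Finset.sum_eq_single k]
  · change (1 : Matrix m m K) (f k) (f k) * N k j = N k j
    rw [Matrix.one_apply_eq, one_mul]
  · intro b _ hb
    simp [hf.eq_iff, hb.symm]
  · simp

/-- Entries of `E_f · N` off the image rows vanish. [folklore] -/
theorem one_submatrix_mul_apply_of_ne [Fintype m₂] [DecidableEq m] (f : m₂ → m)
    (N : Matrix m₂ n₂ K) {i : m} (hi : ∀ k, f k ≠ i) (j : n₂) :
    ((1 : Matrix m m K).submatrix id f * N) i j = 0 := by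
  rw [Matrix.mul_apply]
  refine Finset.sum_eq_zero fun k _ => ?_
  simp [(hi k).symm]

/-- Entries of `N · E^g` on the image columns (`E^g = 1[g, ·]`, `g` injective): column `g k` of
`N E^g` is column `k` of `N`. [folklore] -/
theorem mul_one_submatrix_apply_self [Fintype n₂] [DecidableEq n] (g : n₂ → n)
    (hg : Function.Injective g) (N : Matrix m₂ n₂ K) (i : m₂) (k : n₂) :
    (N * (1 : Matrix n n K).submatrix g id) i (g k) = N i k := by
  rw [Matrix.mul_apply, Finset.sum_eq_single k]
  · change N i k * (1 : Matrix n n K) (g k) (g k) = N i k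
    rw [Matrix.one_apply_eq, mul_one]
  · intro b _ hb
    simp [hg.eq_iff, hb]
  · simp

/-- Entries of `N · E^g` off the image columns vanish. [folklore] -/
theorem mul_one_submatrix_apply_of_ne [Fintype n₂] [DecidableEq n] (g : n₂ → n)
    (N : Matrix m₂ n₂ K) (i : m₂) {j : n} (hj : ∀ k, g k ≠ j) :
    (N * (1 : Matrix n n K).submatrix g id) i j = 0 := by
  rw [Matrix.mul_apply]
  refine Finset.sum_eq_zero fun k _ => ?_
  simp [hj k]

/-- The zero-padding `E_f N E^g` of `N` (rows placed at `f`, columns at `g`) has entry `N k k'`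
at `(f k, g k')`. [folklore] -/
theorem pad_apply_self [Fintype m₂] [Fintype n₂] [DecidableEq m] [DecidableEq n] (f : m₂ → m)
    (hf : Function.Injective f) (g : n₂ → n) (hg : Function.Injective g) (N : Matrix m₂ n₂ K)
    (k : m₂) (k' : n₂) :
    ((1 : Matrix m m K).submatrix id f * N * (1 : Matrix n n K).submatrix g id) (f k) (g k') =
      N k k' := by
  rw [mul_one_submatrix_apply_self g hg, one_submatrix_mul_apply_self f hf]

/-- The zero-padding `E_f N E^g` vanishes off the rows `f`. [folklore] -/
theorem pad_apply_of_row_ne [Fintype m₂] [Fintype n₂] [DecidableEq m] [DecidableEq n]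
    (f : m₂ → m) (g : n₂ → n) (N : Matrix m₂ n₂ K) {i : m} (hi : ∀ k, f k ≠ i) (j : n) :
    ((1 : Matrix m m K).submatrix id f * N * (1 : Matrix n n K).submatrix g id) i j = 0 := by
  rw [Matrix.mul_apply]
  refine Finset.sum_eq_zero fun k' _ => ?_
  rw [one_submatrix_mul_apply_of_ne f N hi]
  exact zero_mul _

/-- The zero-padding `E_f N E^g` vanishes off the columns `g`. [folklore] -/
theorem pad_apply_of_col_ne [Fintype m₂] [Fintype n₂] [DecidableEq m] [DecidableEq n]
    (f : m₂ → m) (g : n₂ → n) (N : Matrix m₂ n₂ K) (i : m) {j : n} (hj : ∀ k, g k ≠ j) :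
    ((1 : Matrix m m K).submatrix id f * N * (1 : Matrix n n K).submatrix g id) i j = 0 :=
  mul_one_submatrix_apply_of_ne g _ i hj

/-- `rank (X N Y) ≤ rank N`. [folklore] -/
theorem rank_mul_mul_le {m' n' : Type*} [Fintype m'] [Fintype n'] [Fintype n]
    (X : Matrix m m' K) (N : Matrix m' n' K) (Y : Matrix n' n K) : (X * N * Y).rank ≤ N.rank :=
  (Matrix.rank_mul_le_left _ _).trans (Matrix.rank_mul_le_right _ _)

/-- `N ↦ X N Y` as a `K`-linear map (Mathlib's `mulRightLinearMap _ _ Y ∘ₗ mulLeftLinearMap _ _ X`),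
unfolded. [folklore] -/
theorem mulRight_comp_mulLeft_apply {m' n' : Type*} [Fintype m'] [Fintype n']
    (X : Matrix m m' K) (Y : Matrix n' n K) (N : Matrix m' n' K) :
    (mulRightLinearMap m K Y ∘ₗ mulLeftLinearMap n' K X) N = X * N * Y := rfl

end LinearAlgebra

/-! ### Rational structure: complexified rational matrices -/

section Rational

variable {m n : Type*}

/-- `1_ℚ ⊗ ℂ = 1_ℂ`. [folklore] -/
@[simp] theorem map_one_algebraMap_rat [DecidableEq m] :
    (1 : Matrix m m ℚ).map (algebraMap ℚ ℂ) = (1 : Matrix m m ℂ) :=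
  Matrix.map_one _ (map_zero _) (map_one _)

/-- Submatrices of `1_ℚ` complexify to the same submatrices of `1_ℂ`. [folklore] -/
@[simp] theorem one_submatrix_map_algebraMap_rat [DecidableEq m] {m₂ n₂ : Type*} (e₁ : m₂ → m)
    (e₂ : n₂ → m) :
    ((1 : Matrix m m ℚ).submatrix e₁ e₂).map (algebraMap ℚ ℂ) =
      (1 : Matrix m m ℂ).submatrix e₁ e₂ := by
  rw [← Matrix.submatrix_map, map_one_algebraMap_rat]

/-- `N ↦ X N Y` with `X, Y` rational maps rational matrices to rational matrices:
`X (A ⊗ 1) Y = (X A Y) ⊗ 1`. [folklore] -/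
theorem map_mul_map_mul_map_algebraMap_rat {m' n' : Type*} [Fintype m'] [Fintype n']
    (X : Matrix m m' ℚ) (A : Matrix m' n' ℚ) (Y : Matrix n' n ℚ) :
    X.map (algebraMap ℚ ℂ) * A.map (algebraMap ℚ ℂ) * Y.map (algebraMap ℚ ℂ) =
      (X * A * Y).map (algebraMap ℚ ℂ) := by
  simp [Matrix.map_mul]

/-- A `ℚ`-subspace `S ⊆ ℂ` containing the entries of `M` contains the entries of `X M Y` for
rational `X, Y` (they are `ℚ`-linear combinations of entries of `M`). Used with `S = 𝓛`:
"`M₂` is a `d₂ × l₂` matrix with coefficients in `𝓛`".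
[cite: Roy1995, §1 proof of Corollary 1.3 (p. 53)] -/
theorem map_mul_mul_map_apply_mem {m' n' : Type*} [Fintype m'] [Fintype n'] (S : Submodule ℚ ℂ)
    {M : Matrix m' n' ℂ} (hM : ∀ i j, M i j ∈ S) (X : Matrix m m' ℚ) (Y : Matrix n' n ℚ)
    (i : m) (j : n) : (X.map (algebraMap ℚ ℂ) * M * Y.map (algebraMap ℚ ℂ)) i j ∈ S := by
  simp only [Matrix.mul_apply, Matrix.map_apply]
  refine Submodule.sum_mem _ fun b _ => ?_
  rw [Finset.sum_mul]
  refine Submodule.sum_mem _ fun a _ => ?_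
  have : algebraMap ℚ ℂ (X i a) * M a b * algebraMap ℚ ℂ (Y b j) = (X i a * Y b j) • M a b := by
    rw [Algebra.smul_def, map_mul]
    ring
  rw [this]
  exact Submodule.smul_mem _ _ (hM a b)

end Rational

/-! ### Subspaces defined over `ℚ` and rational envelopes -/

variable {d l d' l' : ℕ}

/-- The image of a subspace defined over `ℚ` under a `ℂ`-linear map sending rational matrices
to rational matrices is defined over `ℚ`. [folklore] -/
theorem IsDefinedOverRat.map {T : Submodule ℂ (Matrix (Fin d') (Fin l') ℂ)}
    (hT : IsDefinedOverRat T) (f : Matrix (Fin d') (Fin l') ℂ →ₗ[ℂ] Matrix (Fin d) (Fin l) ℂ)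
    (hf : ∀ A : Matrix (Fin d') (Fin l') ℚ, ∃ B : Matrix (Fin d) (Fin l) ℚ,
      f (A.map (algebraMap ℚ ℂ)) = B.map (algebraMap ℚ ℂ)) :
    IsDefinedOverRat (T.map f) := by
  obtain ⟨S, rfl⟩ := hT
  choose g hg using hf
  refine ⟨g '' S, ?_⟩
  rw [Submodule.map_span, Set.image_image, Set.image_image]
  congr 1
  exact Set.image_congr fun A _ => hg A

/-- The sum of two subspaces defined over `ℚ` is defined over `ℚ`. [folklore] -/
theorem IsDefinedOverRat.sup {T₁ T₂ : Submodule ℂ (Matrix (Fin d) (Fin l) ℂ)}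
    (h₁ : IsDefinedOverRat T₁) (h₂ : IsDefinedOverRat T₂) : IsDefinedOverRat (T₁ ⊔ T₂) := by
  obtain ⟨S₁, rfl⟩ := h₁
  obtain ⟨S₂, rfl⟩ := h₂
  exact ⟨S₁ ∪ S₂, by rw [Set.image_union, Submodule.span_union]⟩

/-- A rational envelope of rank `≤ k` — "`M_{d,l}(k)` contains a subspace of `M_{d,l}` defined
over `ℚ` containing `M`" — bounds the structural rank by `k` (`structuralRank` is the least such
`k`). [cite: Roy1995, §1 Remark (i) p. 54] -/
theorem structuralRank_le_of_exists_isDefinedOverRat {M : Matrix (Fin d) (Fin l) ℂ} {k : ℕ}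
    (h : ∃ T : Submodule ℂ (Matrix (Fin d) (Fin l) ℂ),
      IsDefinedOverRat T ∧ M ∈ T ∧ ∀ N ∈ T, N.rank ≤ k) :
    structuralRank M ≤ k :=
  Nat.sInf_le h

/-- `T = M_{d,l}` is a rational envelope of rank `≤ k` as soon as `k ≥ l` ("If `l ≤ r`, the
corollary is verified with `S = T = M_{d,l}`").
[cite: Roy1995, §1 proof of Corollary 1.3 (p. 53)] -/
theorem exists_isDefinedOverRat_of_width_le (M : Matrix (Fin d) (Fin l) ℂ) {k : ℕ} (hk : l ≤ k) :
    ∃ T : Submodule ℂ (Matrix (Fin d) (Fin l) ℂ),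
      IsDefinedOverRat T ∧ M ∈ T ∧ ∀ N ∈ T, N.rank ≤ k :=
  ⟨⊤, isDefinedOverRat_top, Submodule.mem_top, fun N _ => N.rank_le_width.trans hk⟩

/-- `T = M_{d,l}` is a rational envelope of rank `≤ k` as soon as `k ≥ d` (transpose of the
previous case). [cite: Roy1995, §1 proof of Corollary 1.3 (p. 53)] -/
theorem exists_isDefinedOverRat_of_height_le (M : Matrix (Fin d) (Fin l) ℂ) {k : ℕ} (hk : d ≤ k) :
    ∃ T : Submodule ℂ (Matrix (Fin d) (Fin l) ℂ),
      IsDefinedOverRat T ∧ M ∈ T ∧ ∀ N ∈ T, N.rank ≤ k :=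
  ⟨⊤, isDefinedOverRat_top, Submodule.mem_top, fun N _ => N.rank_le_height.trans hk⟩

/-- **Transport of rational envelopes**: along a `ℂ`-linear map `f` sending rational matrices to
rational matrices and not increasing ranks, a rational envelope of `M` of rank `≤ k` maps to one
of `f M` (of rank `≤ k'` for any `k' ≥ k`). [folklore] -/
theorem exists_isDefinedOverRat_map {M : Matrix (Fin d') (Fin l') ℂ} {k k' : ℕ}
    (h : ∃ T : Submodule ℂ (Matrix (Fin d') (Fin l') ℂ),
      IsDefinedOverRat T ∧ M ∈ T ∧ ∀ N ∈ T, N.rank ≤ k)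
    (f : Matrix (Fin d') (Fin l') ℂ →ₗ[ℂ] Matrix (Fin d) (Fin l) ℂ)
    (hf : ∀ A : Matrix (Fin d') (Fin l') ℚ, ∃ B : Matrix (Fin d) (Fin l) ℚ,
      f (A.map (algebraMap ℚ ℂ)) = B.map (algebraMap ℚ ℂ))
    (hrank : ∀ N, (f N).rank ≤ N.rank) (hk : k ≤ k') :
    ∃ T : Submodule ℂ (Matrix (Fin d) (Fin l) ℂ),
      IsDefinedOverRat T ∧ f M ∈ T ∧ ∀ N ∈ T, N.rank ≤ k' := by
  obtain ⟨T, hT, hMT, hTk⟩ := h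
  refine ⟨T.map f, hT.map f hf, Submodule.mem_map_of_mem hMT, ?_⟩
  rintro _ ⟨N, hN, rfl⟩
  exact (hrank N).trans ((hTk N hN).trans hk)

/-- Transport along `N ↦ X N Y` with `X ∈ M_{d,d'}(ℚ)`, `Y ∈ M_{l',l}(ℚ)` (e.g. `P⁻¹ · Q⁻¹`,
padding into a block, `E ·`). [folklore] -/
theorem exists_isDefinedOverRat_map_mul_mul_map {M : Matrix (Fin d') (Fin l') ℂ} {k k' : ℕ}
    (h : ∃ T : Submodule ℂ (Matrix (Fin d') (Fin l') ℂ),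
      IsDefinedOverRat T ∧ M ∈ T ∧ ∀ N ∈ T, N.rank ≤ k)
    (X : Matrix (Fin d) (Fin d') ℚ) (Y : Matrix (Fin l') (Fin l) ℚ) (hk : k ≤ k') :
    ∃ T : Submodule ℂ (Matrix (Fin d) (Fin l) ℂ), IsDefinedOverRat T ∧
      X.map (algebraMap ℚ ℂ) * M * Y.map (algebraMap ℚ ℂ) ∈ T ∧ ∀ N ∈ T, N.rank ≤ k' :=
  exists_isDefinedOverRat_map h
    (mulRightLinearMap (Fin d) ℂ (Y.map (algebraMap ℚ ℂ)) ∘ₗ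
      mulLeftLinearMap (Fin l') ℂ (X.map (algebraMap ℚ ℂ)))
    (fun A => ⟨X * A * Y, by rw [mulRight_comp_mulLeft_apply, map_mul_map_mul_map_algebraMap_rat]⟩)
    (fun N => rank_mul_mul_le _ N _) hk

/-- Transport along transposition. [folklore] -/
theorem exists_isDefinedOverRat_transpose {M : Matrix (Fin d) (Fin l) ℂ} {k : ℕ}
    (h : ∃ T : Submodule ℂ (Matrix (Fin d) (Fin l) ℂ),
      IsDefinedOverRat T ∧ M ∈ T ∧ ∀ N ∈ T, N.rank ≤ k) :
    ∃ T : Submodule ℂ (Matrix (Fin l) (Fin d) ℂ),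
      IsDefinedOverRat T ∧ M.transpose ∈ T ∧ ∀ N ∈ T, N.rank ≤ k :=
  exists_isDefinedOverRat_map h (Matrix.transposeLinearEquiv (Fin d) (Fin l) ℂ ℂ).toLinearMap
    (fun A => ⟨A.transpose, by simp [Matrix.transpose_map]⟩)
    (fun N => by simp [Matrix.rank_transpose]) le_rfl

/-! ### "Without loss of generality the rows are `ℚ`-linearly independent" -/

/-- **Dropping a `ℚ`-dependent row.** If the rows of `M` (`(d'+1) × l`) are `ℚ`-linearly
dependent, then for some row index `i₀` and some rational `(d'+1) × d'` matrix `E` one has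
`M = E · M'`, where `M'` is `M` deprived of its row `i₀`: a relation `∑ gᵢ Mᵢ = 0` with
`g_{i₀} ≠ 0` expresses row `i₀` rationally in the others. (Roy: "Without loss of generality we may
assume that the rows of `M` are `ℚ`-linearly independent".)
[cite: Roy1995, §1 proof of Corollary 1.3 (p. 53)] -/
theorem exists_eq_map_mul_submatrix_succAbove {d' l : ℕ} (M : Matrix (Fin (d' + 1)) (Fin l) ℂ)
    (hdep : ¬ LinearIndependent ℚ (fun i => M i)) :
    ∃ (i₀ : Fin (d' + 1)) (E : Matrix (Fin (d' + 1)) (Fin d') ℚ),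
      M = E.map (algebraMap ℚ ℂ) * M.submatrix (Fin.succAbove i₀) id := by
  obtain ⟨g, hg, i₀, hi₀⟩ := Fintype.not_linearIndependent_iff.mp hdep
  refine ⟨i₀, Matrix.of (Fin.insertNth (α := fun _ => Fin d' → ℚ) i₀
    (fun k => -g (i₀.succAbove k) / g i₀) (fun k => (1 : Matrix (Fin d') (Fin d') ℚ) k)), ?_⟩
  ext i j
  rcases Fin.eq_self_or_eq_succAbove i₀ i with hi | ⟨k, rfl⟩
  · rw [hi]
    have hj := congrFun hg j
    simp only [Finset.sum_apply, Pi.smul_apply, Pi.zero_apply, Rat.smul_def] at hj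
    rw [Fin.sum_univ_succAbove _ i₀] at hj
    have hg0 : (g i₀ : ℂ) ≠ 0 := by exact_mod_cast hi₀
    simp only [Matrix.mul_apply, Matrix.map_apply, Matrix.of_apply, Fin.insertNth_apply_same,
      Matrix.submatrix_apply, id_eq, eq_ratCast]
    have hsum : ∑ k, ((-g (i₀.succAbove k) / g i₀ : ℚ) : ℂ) * M (i₀.succAbove k) j =
        (-(g i₀ : ℂ)⁻¹) * ∑ k, (g (i₀.succAbove k) : ℂ) * M (i₀.succAbove k) j := by
      rw [Finset.mul_sum]
      refine Finset.sum_congr rfl fun k _ => ?_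
      push_cast
      ring
    rw [hsum]
    field_simp
    linear_combination hj
  · simp [Matrix.mul_apply, Fin.insertNth_apply_succAbove, Matrix.one_apply]

/-! ### Roy's Corollary 1.3 (`T`-part) from Theorem 1.2 -/

/-- **Roy 1995, Corollary 1.3 (`T`-part), from Theorem 1.2 — the induction.** Assuming
Waldschmidt's linear subgroup theorem for matrices (`waldschmidt1981_linearSubgroup_matrix`), every
`d × l` matrix `M` with entries in `𝓛` has a rational envelope of rank `≤ 2 rank M`: there is a
subspace `T ⊆ M_{d,l}` defined over `ℚ` with `M ∈ T ⊆ M_{d,l}(2r)`. Strong induction on `d + l`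
following the printed proof (see the module docstring for the step-by-step correspondence).
[cite: Roy1995, §1 Corollary 1.3 and its proof (pp. 52–53)] -/
theorem exists_isDefinedOverRat_two_mul_rank_of_linearSubgroup
    (hLST : waldschmidt1981_linearSubgroup_matrix) (n : ℕ) :
    ∀ (d l : ℕ), d + l = n → ∀ M : Matrix (Fin d) (Fin l) ℂ, (∀ i j, M i j ∈ logQSpan) →
      ∃ T : Submodule ℂ (Matrix (Fin d) (Fin l) ℂ),
        IsDefinedOverRat T ∧ M ∈ T ∧ ∀ N ∈ T, N.rank ≤ 2 * M.rank := by
  induction n using Nat.strong_induction_on with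
  | _ n ih => ?_
  intro d l hdl M hM
  -- Trivial cases: `T = M_{d,l}`.
  by_cases hd : d ≤ 2 * M.rank
  · exact exists_isDefinedOverRat_of_height_le M hd
  by_cases hl : l ≤ 2 * M.rank
  · exact exists_isDefinedOverRat_of_width_le M hl
  push Not at hd hl
  obtain ⟨d', rfl⟩ : ∃ d', d = d' + 1 := ⟨d - 1, by omega⟩
  obtain ⟨l', rfl⟩ : ∃ l', l = l' + 1 := ⟨l - 1, by omega⟩
  -- WLOG the rows are `ℚ`-linearly independent.
  by_cases hrows : LinearIndependent ℚ (fun i => M i)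
  swap
  · obtain ⟨i₀, E, hE⟩ := exists_eq_map_mul_submatrix_succAbove M hrows
    have hM' : ∀ i j, M.submatrix (Fin.succAbove i₀) id i j ∈ logQSpan := fun i j => hM _ _
    have ih' := ih (d' + (l' + 1)) (by omega) d' (l' + 1) rfl _ hM'
    have hle : (M.submatrix (Fin.succAbove i₀) id).rank ≤ M.rank := Matrix.rank_submatrix_le _ _ _
    have key := exists_isDefinedOverRat_map_mul_mul_map ih' E
      (1 : Matrix (Fin (l' + 1)) (Fin (l' + 1)) ℚ) (Nat.mul_le_mul_left 2 hle)
    rwa [map_one_algebraMap_rat, Matrix.mul_one, ← hE] at key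
  -- WLOG the columns are `ℚ`-linearly independent (transpose).
  by_cases hcols : LinearIndependent ℚ (fun j => M.transpose j)
  swap
  · obtain ⟨j₀, E, hE⟩ := exists_eq_map_mul_submatrix_succAbove M.transpose hcols
    have hM' : ∀ i j, M.transpose.submatrix (Fin.succAbove j₀) id i j ∈ logQSpan :=
      fun i j => hM _ _
    have ih' := ih (l' + (d' + 1)) (by omega) l' (d' + 1) rfl _ hM'
    have hle : (M.transpose.submatrix (Fin.succAbove j₀) id).rank ≤ M.rank :=
      (Matrix.rank_submatrix_le _ _ _).trans (Matrix.rank_transpose M).le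
    have key := exists_isDefinedOverRat_map_mul_mul_map ih' E
      (1 : Matrix (Fin (d' + 1)) (Fin (d' + 1)) ℚ) (Nat.mul_le_mul_left 2 hle)
    rw [map_one_algebraMap_rat, Matrix.mul_one, ← hE] at key
    simpa using exists_isDefinedOverRat_transpose key
  -- Main case: Theorem 1.2 applies.
  have hLSThyp : LSTHypothesis (d' + 1) (l' + 1) M.rank := by
    rw [lstHypothesis_iff]
    nlinarith [hd, hl]
  obtain ⟨P, Q, hP, hQ, d₁, l₁, r₁, hd₁, hl₁, hr₁, h1, h2, hzero, hrank₁⟩ :=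
    hLST _ _ M (Nat.succ_pos _) (Nat.succ_pos _) hM hrows hcols hLSThyp
  set A : Matrix (Fin (d' + 1)) (Fin (l' + 1)) ℂ :=
    P.map (algebraMap ℚ ℂ) * M * Q.map (algebraMap ℚ ℂ) with hA
  have hArank : A.rank ≤ M.rank :=
    (Matrix.rank_mul_le_left _ _).trans (Matrix.rank_mul_le_right _ _)
  -- "Since `d > 2r`, the inequalities (1.2) imply `d₁ > 2r₁` and `l₁ < 2r₁`."
  have hd₁r₁ : 2 * r₁ < d₁ := by
    by_contra hcon
    push Not at hcon
    nlinarith [hd, hcon, h1, hr₁]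
  have hr₁d₁ : r₁ ≤ d₁ := by omega
  have hl₁r₁ : l₁ < 2 * r₁ := by
    by_contra hcon
    push Not at hcon
    nlinarith [hd₁r₁, hcon, h2, hr₁, hr₁d₁, Nat.mul_le_mul hcon hr₁d₁]
  -- The lower right block `M₂`.
  let ρ : Fin (d' + 1 - d₁) → Fin (d' + 1) := fun k => ⟨d₁ + k, by omega⟩
  let σ : Fin (l' + 1 - l₁) → Fin (l' + 1) := fun k => ⟨l₁ + k, by omega⟩
  have hρ : Function.Injective ρ := by
    intro a b hab
    simp only [ρ, Fin.mk.injEq] at hab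
    exact Fin.ext (by omega)
  have hσ : Function.Injective σ := by
    intro a b hab
    simp only [σ, Fin.mk.injEq] at hab
    exact Fin.ext (by omega)
  set M₂ : Matrix (Fin (d' + 1 - d₁)) (Fin (l' + 1 - l₁)) ℂ := A.submatrix ρ σ with hM₂
  -- "`r₂ ≤ r − r₁`"
  have hblock : r₁ + M₂.rank ≤ A.rank := by
    have := rank_submatrix_add_rank_submatrix_le A (Fin.castLE hd₁) (Fin.castLE hl₁) ρ σ
      (fun i j => hzero _ _ (by simp) (Nat.le_add_right _ _))
    rwa [hrank₁] at this
  -- Induction hypothesis for `M₂` ("`M₂` is a `d₂ × l₂` matrix with coefficients in `𝓛`").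
  have hAmem : ∀ i j, A i j ∈ logQSpan := map_mul_mul_map_apply_mem logQSpan hM P Q
  have hM₂mem : ∀ i j, M₂ i j ∈ logQSpan := fun i j => hAmem _ _
  obtain ⟨T₂, hT₂, hM₂T₂, hT₂k⟩ :=
    ih ((d' + 1 - d₁) + (l' + 1 - l₁)) (by omega) _ _ rfl M₂ hM₂mem
  -- `T̃ = {(N₁ 0; N₃ N₂) : N₂ ∈ T₂}` = (matrices supported on the first `l₁` columns) + pad(T₂).
  let Xκ : Matrix (Fin (d' + 1)) (Fin (d' + 1)) ℚ := 1
  let Yκ : Matrix (Fin l₁) (Fin (l' + 1)) ℚ := (1 : Matrix _ _ ℚ).submatrix (Fin.castLE hl₁) id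
  let Xι : Matrix (Fin (d' + 1)) (Fin (d' + 1 - d₁)) ℚ := (1 : Matrix _ _ ℚ).submatrix id ρ
  let Yι : Matrix (Fin (l' + 1 - l₁)) (Fin (l' + 1)) ℚ := (1 : Matrix _ _ ℚ).submatrix σ id
  let κ : Matrix (Fin (d' + 1)) (Fin l₁) ℂ →ₗ[ℂ] Matrix (Fin (d' + 1)) (Fin (l' + 1)) ℂ :=
    mulRightLinearMap _ ℂ (Yκ.map (algebraMap ℚ ℂ)) ∘ₗ
      mulLeftLinearMap _ ℂ (Xκ.map (algebraMap ℚ ℂ))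
  let ι : Matrix (Fin (d' + 1 - d₁)) (Fin (l' + 1 - l₁)) ℂ →ₗ[ℂ]
      Matrix (Fin (d' + 1)) (Fin (l' + 1)) ℂ :=
    mulRightLinearMap _ ℂ (Yι.map (algebraMap ℚ ℂ)) ∘ₗ
      mulLeftLinearMap _ ℂ (Xι.map (algebraMap ℚ ℂ))
  have hκ : ∀ N, κ N = Xκ.map (algebraMap ℚ ℂ) * N * Yκ.map (algebraMap ℚ ℂ) := fun N => rfl
  have hι : ∀ N, ι N = Xι.map (algebraMap ℚ ℂ) * N * Yι.map (algebraMap ℚ ℂ) := fun N => rfl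
  have hdef : IsDefinedOverRat ((⊤ : Submodule ℂ (Matrix (Fin (d' + 1)) (Fin l₁) ℂ)).map κ ⊔
      T₂.map ι) :=
    (isDefinedOverRat_top.map κ fun B =>
        ⟨_, by rw [hκ, map_mul_map_mul_map_algebraMap_rat]⟩).sup
      (hT₂.map ι fun B => ⟨_, by rw [hι, map_mul_map_mul_map_algebraMap_rat]⟩)
  -- `A = (A₁ 0; A₃ 0) + pad(M₂)`.
  have hAdecomp : A = κ (A.submatrix id (Fin.castLE hl₁)) + ι M₂ := by
    ext i j
    simp only [hκ, hι, Xκ, Yκ, Xι, Yι, one_submatrix_map_algebraMap_rat,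
      map_one_algebraMap_rat, Matrix.one_mul, Matrix.add_apply]
    by_cases hj : (j : ℕ) < l₁
    · obtain ⟨j', rfl⟩ : ∃ j' : Fin l₁, Fin.castLE hl₁ j' = j := ⟨⟨j, hj⟩, Fin.ext rfl⟩
      rw [mul_one_submatrix_apply_self _ (Fin.castLE_injective hl₁),
        pad_apply_of_col_ne _ _ _ _ (fun k hk => ?_), add_zero]
      · rfl
      · have := congrArg Fin.val hk
        simp only [σ, Fin.val_castLE] at this
        omega
    · push Not at hj
      rw [mul_one_submatrix_apply_of_ne _ _ _ (fun k hk => ?_), zero_add]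
      swap
      · have := congrArg Fin.val hk
        simp only [Fin.val_castLE] at this
        omega
      by_cases hi : (i : ℕ) < d₁
      · rw [pad_apply_of_row_ne _ _ _ (fun k hk => ?_)]
        · exact hzero i j hi hj
        · have := congrArg Fin.val hk
          simp only [ρ] at this
          omega
      · push Not at hi
        obtain ⟨k, rfl⟩ : ∃ k : Fin (d' + 1 - d₁), ρ k = i :=
          ⟨⟨i - d₁, by omega⟩, Fin.ext (by simp only [ρ]; omega)⟩
        obtain ⟨k', rfl⟩ : ∃ k' : Fin (l' + 1 - l₁), σ k' = j :=
          ⟨⟨j - l₁, by omega⟩, Fin.ext (by simp only [σ]; omega)⟩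
        rw [pad_apply_self _ hρ _ hσ]
        rfl
  -- "since `r₁ + r₂ ≤ r` and `l₁ < 2r₁`, we also have `T ⊆ M_{d,l}(2r)`"
  have hTrank : ∀ N ∈ (⊤ : Submodule ℂ (Matrix (Fin (d' + 1)) (Fin l₁) ℂ)).map κ ⊔ T₂.map ι,
      N.rank ≤ 2 * M.rank := by
    intro N hN
    obtain ⟨u, hu, v, hv, rfl⟩ := Submodule.mem_sup.mp hN
    obtain ⟨N₁, -, rfl⟩ := Submodule.mem_map.mp hu
    obtain ⟨N₂, hN₂, rfl⟩ := Submodule.mem_map.mp hv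
    have hu1 : (κ N₁).rank ≤ l₁ := (hκ N₁).symm ▸ (rank_mul_mul_le _ N₁ _).trans N₁.rank_le_width
    have hv2 : (ι N₂).rank ≤ 2 * M₂.rank :=
      (hι N₂).symm ▸ (rank_mul_mul_le _ N₂ _).trans (hT₂k N₂ hN₂)
    have hadd := rank_add_le_rank_add_rank (κ N₁) (ι N₂)
    omega
  have hAenv : ∃ T : Submodule ℂ (Matrix (Fin (d' + 1)) (Fin (l' + 1)) ℂ),
      IsDefinedOverRat T ∧ A ∈ T ∧ ∀ N ∈ T, N.rank ≤ 2 * M.rank := by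
    refine ⟨_, hdef, ?_, hTrank⟩
    rw [hAdecomp]
    exact Submodule.add_mem_sup (Submodule.mem_map_of_mem Submodule.mem_top)
      (Submodule.mem_map_of_mem hM₂T₂)
  -- `T = P⁻¹ T̃ Q⁻¹`.
  have hPinv : P⁻¹ * P = 1 := Matrix.nonsing_inv_mul P ((Matrix.isUnit_iff_isUnit_det P).mp hP)
  have hQinv : Q * Q⁻¹ = 1 := Matrix.mul_nonsing_inv Q ((Matrix.isUnit_iff_isUnit_det Q).mp hQ)
  have hback : P⁻¹.map (algebraMap ℚ ℂ) * A * Q⁻¹.map (algebraMap ℚ ℂ) = M := by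
    have : P⁻¹.map (algebraMap ℚ ℂ) * A * Q⁻¹.map (algebraMap ℚ ℂ) =
        (P⁻¹ * P).map (algebraMap ℚ ℂ) * M * (Q * Q⁻¹).map (algebraMap ℚ ℂ) := by
      simp only [hA, Matrix.map_mul, Matrix.mul_assoc]
    rw [this, hPinv, hQinv, map_one_algebraMap_rat, map_one_algebraMap_rat, Matrix.one_mul,
      Matrix.mul_one]
  have hMenv := exists_isDefinedOverRat_map_mul_mul_map hAenv P⁻¹ Q⁻¹ le_rfl
  rwa [hback] at hMenv

/-- **`s ≤ 2r` from Theorem 1.2** (Roy 1995, Corollary 1.3 / Remark (i)): under Waldschmidt's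
linear subgroup theorem for matrices, the structural rank of a matrix with entries in `𝓛` is at
most twice its rank. [cite: Roy1995, §1 Corollary 1.3 and Remark (i) p. 54] -/
theorem structuralRank_le_two_mul_rank_of_linearSubgroup
    (hLST : waldschmidt1981_linearSubgroup_matrix) (M : Matrix (Fin d) (Fin l) ℂ)
    (hM : ∀ i j, M i j ∈ logQSpan) : structuralRank M ≤ 2 * M.rank :=
  structuralRank_le_of_exists_isDefinedOverRat
    (exists_isDefinedOverRat_two_mul_rank_of_linearSubgroup hLST (d + l) d l rfl M hM)

/-- **The named fact `roy1995_structuralRank_le_two_mul_rank` follows from Theorem 1.2**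
(`waldschmidt1981_linearSubgroup_matrix`): this is the complete printed deduction of the
`T`-part of Corollary 1.3; the transcendence input (Waldschmidt 1981, Schneider's method in
several variables) remains the named fact. [cite: Roy1995, §1 Corollary 1.3 and Remark (i) p. 54] -/
theorem roy1995_structuralRank_le_two_mul_rank_of_linearSubgroup
    (hLST : waldschmidt1981_linearSubgroup_matrix) : roy1995_structuralRank_le_two_mul_rank :=
  fun _ _ M hM => structuralRank_le_two_mul_rank_of_linearSubgroup hLST M hM

/-- **Roy's `r ≤ s ≤ 2r`** (Remark (i)) under Theorem 1.2: the trivial half is the companion's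
`rank_le_structuralRank`, the other half the deduction above.
[cite: Roy1995, §1 Remark (i) p. 54] -/
theorem rank_le_structuralRank_and_le_two_mul_rank_of_linearSubgroup
    (hLST : waldschmidt1981_linearSubgroup_matrix) (M : Matrix (Fin d) (Fin l) ℂ)
    (hM : ∀ i j, M i j ∈ logQSpan) :
    M.rank ≤ structuralRank M ∧ structuralRank M ≤ 2 * M.rank :=
  ⟨rank_le_structuralRank M, structuralRank_le_two_mul_rank_of_linearSubgroup hLST M hM⟩

end Literature.Barriers.Schanuel
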